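import Summits.HodgeConjecture.HodgeConjecture.Theorems.MarkmanPartnerTransportK3Sq2KugaSatakeSelfTransposeHK

/-!
# Route MarkmanPartnerTransport · support `PartnerTransport` (stmt-HodgeConjecture-19650) ∕ crux #5 —
# programme «KS-MIXED», step M3: the Lefschetz–transposes between a SURFACE and a FOURFOLD through one
# Kuga–Satake square

Mixed-dimension twins of gen 15's `exists_lefschetzTranspose₂` (two surfaces) and
`exists_lefschetzTransposeHK` (one fourfold, this seat p689744). Let `Y` be smooth projective of dimension `m ≥ 2`
(the square `A × A` of a Kuga–Satake variety), `Z` smooth projective of dimension `k` (the SOURCE: a K3 surface or a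
`K3^{[2]}`-type fourfold) and `O_Z : H²(Z) → H²(Y)`, `O : H²(target) → H²(Y)` maps INDUCED BY ALGEBRAIC CYCLES.

* `exists_lefschetzTranspose_toFourfold` — TARGET a smooth projective fourfold `X` with `B(X)`: there is ONE
  `R : H²(Y) → H²(X)` (namely `*_L ∘ ᵗO_X ∘ L_η^{m-2}`, `*_L` algebraic by `B(X)`, injective by hard Lefschetz) with
  `R ∘ O_Z : H²(Z) → H²(X)` and `R ∘ O_X : H²(X) → H²(X)` ALGEBRAIC, and `(R ∘ O_X) σ ≠ 0` whenever `O_X σ` is a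
  non-zero `(2,0)`-class with `O_X σ̄ = \overline{O_X σ}` (Hodge–Riemann on `Y`);
  `exists_lefschetzTranspose_toFourfold_of_charlesMarkman` — `B(X)` from the Charles–Markman record for
  `K3^{[2]}`-type `X`.
* `exists_lefschetzTranspose_toSurface` — TARGET a smooth projective surface `S'`: `R = ᵗO_{S'} ∘ L_η^{m-2}` with
  `R ∘ O_Z : H²(Z) → H²(S')` and `R ∘ O_{S'}` algebraic, and the same non-vanishing.

These are the transposes of the mixed Varesco argument (K3 partner `S` of a `K3^{[2]}`-type `X`: correspondences
`S → X` and `X → S` through the common Kuga–Satake square, blueprint «KS-MIXED», HOME/HANDOFF § 19652-p1 g15).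
THEOREMS ONLY; CONDITIONAL only through the displayed hypotheses (`B(X)` resp. the Charles–Markman record); no sorry,
no definition, no named fact. Prover seat hodge-nonav-19652-p1 (gen 15), `--supports stmt-HodgeConjecture-19650`.

References: M. Varesco, Math. Z. 305 (2023) Lemma 4.4, Thm. 4.5, Cor. 4.6, Rem. 5.5; F. Charles, E. Markman,
Compos. Math. 149 (2013) Thm. 1.1; Y. André, Publ. IHÉS 83 (1996) §1.1; C. Voisin, *Hodge Theory I* Thm. 6.32;
W. Fulton, *Intersection Theory* §16.1.
-/

set_option linter.dupNamespace false

noncomputable section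

namespace Summit.HodgeConjecture.HodgeConjecture.Theorems.MarkmanPartnerTransport.KugaSatakeHK

open CategoryTheory Literature.AlgebraicGeometry Literature.AlgebraicGeometry.Motives
open Literature.AlgebraicGeometry.HodgeTheory Literature.AlgebraicTopology.SingularHomology
open Literature.AlgebraicGeometry.Hyperkaehler
open Literature.Geometry.Kaehler (lefschetzPow)
open Summit.HodgeConjecture.HodgeConjecture.Ring2.AbelianAll
open Summit.HodgeConjecture.HodgeConjecture.Theorems.MarkmanPartnerTransport.KugaSatakeSelf

variable {X Y Z S' : SchemeOver ℂ} {m k : ℕ}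

/-- **Lefschetz–transpose INTO A FOURFOLD with `B(X)`, from any source.** For `X` a smooth projective fourfold with
`B(X)`, `Y` smooth projective of dimension `m ≥ 2`, `Z` smooth projective of dimension `k`, and algebraic
`O_Z : H²(Z) → H²(Y)`, `O_X : H²(X) → H²(Y)`: with `R = *_L ∘ ᵗO_X ∘ L_η^{m-2}`, the maps `R ∘ O_Z : H²(Z) → H²(X)` and
`R ∘ O_X` are ALGEBRAIC correspondences, and `(R ∘ O_X) σ ≠ 0` for every `σ` whose image `O_X σ` is a non-zero
`(2,0)`-class with `O_X σ̄ = \overline{O_X σ}`. [cite: Varesco2023, Lemma 4.4, Thm. 4.5 and Cor. 4.6]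
[cite: Andre1996Motifs, §1.1 (p. 10)] [cite: VoisinHodgeI2002, §6.3.2 Thm. 6.32] [cite: Fulton1998, §16.1] -/
theorem exists_lefschetzTranspose_toFourfold (hX : IsSmoothProjective 4 X)
    (hB : ∀ η : complexBetti X 2, StandardConjectureBStar 4 X η) (hY : IsSmoothProjective m Y) (hm : 2 ≤ m)
    (hZ : IsSmoothProjective k Z)
    {OZ : complexBetti Z (2 * 1) →ₗ[ℂ] complexBetti Y 2} {OX : complexBetti X (2 * 1) →ₗ[ℂ] complexBetti Y 2}
    (hOZ : IsAlgebraicCorrespondence m k Y Z OZ) (hOX : IsAlgebraicCorrespondence m 4 Y X OX) :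
    ∃ R : complexBetti Y 2 →ₗ[ℂ] complexBetti X (2 * 1),
      IsAlgebraicCorrespondence 4 k X Z (R ∘ₗ OZ) ∧ IsAlgebraicCorrespondence 4 4 X X (R ∘ₗ OX) ∧
      ∀ σ : complexBetti X (2 * 1), IsOfHodgeType m Y 2 2 0 (OX σ) → OX σ ≠ 0 →
        OX (conjClass _ (2 * 1) σ) = conjClass _ 2 (OX σ) → (R ∘ₗ OX) σ ≠ 0 := by
  obtain ⟨r, hr⟩ : ∃ r, 2 + r = m := ⟨m - 2, by omega⟩
  obtain ⟨D⟩ := nonempty_kaehlerRationalDatum hY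
  obtain ⟨DX⟩ := nonempty_kaehlerRationalDatum hX
  have hη : D.Hη ∈ algebraicClasses Y 1 :=
    lefschetzOneOne_rational_holds hY _ D.isRationalClass_Hη D.isOfHodgeType_Hη
  have hpol : IsPolarizationClass 4 X DX.Hη :=
    ⟨DX.isRationalClass_Hη, lefschetzOneOne_rational_holds hX _ DX.isRationalClass_Hη DX.isOfHodgeType_Hη,
      DX.hasHardLefschetzProperty hX⟩
  have ha : 2 * 3 + 2 * 1 = 2 * 4 := rfl
  have hb : 2 + (2 + 2 * r) = 2 * m := by omega
  obtain ⟨Tt, hTt, hadj⟩ := IsAlgebraicCorrespondence.exists_transpose hY hX ha hb hOX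
  have hΛ : IsAlgebraicCorrespondence 4 4 X X (lefschetzInvolution hpol.hasHardLefschetz ha) :=
    hB DX.Hη hpol (2 * 3) (2 * 1) ha
  have hΛbij := lefschetzInvolution_bijective hpol.hasHardLefschetz ha
  have hR₀ : IsAlgebraicCorrespondence 4 m X Y (Tt ∘ₗ lefschetzPow D.Hη r 2) :=
    IsAlgebraicCorrespondence.comp_lefschetzPow hX hY hη 2 r hTt
  have hR : IsAlgebraicCorrespondence 4 m X Y
      (lefschetzInvolution hpol.hasHardLefschetz ha ∘ₗ (Tt ∘ₗ lefschetzPow D.Hη r 2)) :=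
    IsAlgebraicCorrespondence.comp hX hX hY hR₀ hΛ (by omega)
  have hkZ := IsAlgebraicCorrespondence.le_two_mul hOZ
  refine ⟨lefschetzInvolution hpol.hasHardLefschetz ha ∘ₗ (Tt ∘ₗ lefschetzPow D.Hη r 2),
    IsAlgebraicCorrespondence.comp hX hY hZ hOZ hR (by omega),
    IsAlgebraicCorrespondence.comp hX hY hX hOX hR (by omega), fun σ hσ hσ0 hconj h0 => ?_⟩
  have hHR := cupPairing_conj_lefschetzPow_ne_zero hY D hr hb hσ hσ0
  apply hHR
  have key := hadj (conjClass _ (2 * 1) σ) (lefschetzPow D.Hη r 2 (OX σ))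
  have heven : ((-1 : ℂ) ^ (2 * 1 * (2 + 2 * r))) = 1 := Even.neg_one_pow ⟨2 + 2 * r, by ring⟩
  rw [hconj, heven, one_mul] at key
  rw [key]
  have h0' : Tt (lefschetzPow D.Hη r 2 (OX σ)) = 0 := by
    have h0'' : lefschetzInvolution hpol.hasHardLefschetz ha (Tt (lefschetzPow D.Hη r 2 (OX σ))) = 0 := by
      simpa only [LinearMap.comp_apply] using h0
    exact hΛbij.1 (by rw [h0'', map_zero])
  rw [h0', map_zero, LinearMap.zero_apply]

/-- **Lefschetz–transpose into a smooth projective `K3^{[2]}`-type fourfold from any source**, `B(X)` supplied by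
Charles–Markman (BY NAME). CONDITIONAL on that record. [cite: Varesco2023, Thm. 4.5 and Cor. 4.6]
[cite: CharlesMarkman2013, Thm. 1.1 (§1)] -/
theorem exists_lefschetzTranspose_toFourfold_of_charlesMarkman (hCM : CharlesMarkman2013_lefschetzStandard_K3HilbertType)
    (hX : IsSmoothProjective 4 X) (hK : IsOfK3HilbertSquareType X) (hY : IsSmoothProjective m Y) (hm : 2 ≤ m)
    (hZ : IsSmoothProjective k Z)
    {OZ : complexBetti Z (2 * 1) →ₗ[ℂ] complexBetti Y 2} {OX : complexBetti X (2 * 1) →ₗ[ℂ] complexBetti Y 2}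
    (hOZ : IsAlgebraicCorrespondence m k Y Z OZ) (hOX : IsAlgebraicCorrespondence m 4 Y X OX) :
    ∃ R : complexBetti Y 2 →ₗ[ℂ] complexBetti X (2 * 1),
      IsAlgebraicCorrespondence 4 k X Z (R ∘ₗ OZ) ∧ IsAlgebraicCorrespondence 4 4 X X (R ∘ₗ OX) ∧
      ∀ σ : complexBetti X (2 * 1), IsOfHodgeType m Y 2 2 0 (OX σ) → OX σ ≠ 0 →
        OX (conjClass _ (2 * 1) σ) = conjClass _ 2 (OX σ) → (R ∘ₗ OX) σ ≠ 0 :=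
  exists_lefschetzTranspose_toFourfold hX
    (fun η => CharlesMarkman2013_lefschetzStandard_K3HilbertType.of_squareType hCM hX hK η) hY hm hZ hOZ hOX

/-- **Lefschetz–transpose INTO A SURFACE, from any source.** For `S'` a smooth projective surface, `Y` smooth
projective of dimension `m ≥ 2`, `Z` smooth projective of dimension `k`, and algebraic `O_Z : H²(Z) → H²(Y)`,
`O' : H²(S') → H²(Y)`: with `R = ᵗO' ∘ L_η^{m-2} : H²(Y) → H²(S')`, the maps `R ∘ O_Z : H²(Z) → H²(S')` and `R ∘ O'`
are ALGEBRAIC, and `(R ∘ O') σ' ≠ 0` for every `σ'` whose image `O' σ'` is a non-zero `(2,0)`-class with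
`O' σ̄' = \overline{O' σ'}`. [cite: Varesco2023, Lemma 4.4 and Thm. 4.5] [cite: VoisinHodgeI2002, §6.3.2 Thm. 6.32]
[cite: Fulton1998, §16.1] -/
theorem exists_lefschetzTranspose_toSurface (hS' : IsSmoothProjective 2 S') (hY : IsSmoothProjective m Y)
    (hm : 2 ≤ m) (hZ : IsSmoothProjective k Z)
    {OZ : complexBetti Z (2 * 1) →ₗ[ℂ] complexBetti Y 2} {O' : complexBetti S' (2 * 1) →ₗ[ℂ] complexBetti Y 2}
    (hOZ : IsAlgebraicCorrespondence m k Y Z OZ) (hO' : IsAlgebraicCorrespondence m 2 Y S' O') :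
    ∃ R : complexBetti Y 2 →ₗ[ℂ] complexBetti S' (2 * 1),
      IsAlgebraicCorrespondence 2 k S' Z (R ∘ₗ OZ) ∧ IsAlgebraicCorrespondence 2 2 S' S' (R ∘ₗ O') ∧
      ∀ σ' : complexBetti S' (2 * 1), IsOfHodgeType m Y 2 2 0 (O' σ') → O' σ' ≠ 0 →
        O' (conjClass _ (2 * 1) σ') = conjClass _ 2 (O' σ') → (R ∘ₗ O') σ' ≠ 0 := by
  obtain ⟨r, hr⟩ : ∃ r, 2 + r = m := ⟨m - 2, by omega⟩
  obtain ⟨D⟩ := nonempty_kaehlerRationalDatum hY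
  have hη : D.Hη ∈ algebraicClasses Y 1 :=
    lefschetzOneOne_rational_holds hY _ D.isRationalClass_Hη D.isOfHodgeType_Hη
  have ha : 2 * 1 + 2 * 1 = 2 * 2 := rfl
  have hb : 2 + (2 + 2 * r) = 2 * m := by omega
  obtain ⟨Tt, hTt, hadj⟩ := IsAlgebraicCorrespondence.exists_transpose hY hS' ha hb hO'
  have hR : IsAlgebraicCorrespondence 2 m S' Y (Tt ∘ₗ lefschetzPow D.Hη r 2) :=
    IsAlgebraicCorrespondence.comp_lefschetzPow hS' hY hη 2 r hTt
  have hkZ := IsAlgebraicCorrespondence.le_two_mul hOZ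
  refine ⟨Tt ∘ₗ lefschetzPow D.Hη r 2,
    IsAlgebraicCorrespondence.comp hS' hY hZ hOZ hR (by omega),
    IsAlgebraicCorrespondence.comp hS' hY hS' hO' hR (by omega), fun σ hσ hσ0 hconj h0 => ?_⟩
  have hHR := cupPairing_conj_lefschetzPow_ne_zero hY D hr hb hσ hσ0
  apply hHR
  have key := hadj (conjClass _ (2 * 1) σ) (lefschetzPow D.Hη r 2 (O' σ))
  have heven : ((-1 : ℂ) ^ (2 * 1 * (2 + 2 * r))) = 1 := Even.neg_one_pow ⟨2 + 2 * r, by ring⟩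
  rw [hconj, heven, one_mul] at key
  rw [key]
  have h0' : Tt (lefschetzPow D.Hη r 2 (O' σ)) = 0 := by
    rw [LinearMap.comp_apply, LinearMap.comp_apply] at h0
    exact h0
  rw [h0', map_zero, LinearMap.zero_apply]

end Summit.HodgeConjecture.HodgeConjecture.Theorems.MarkmanPartnerTransport.KugaSatakeHK

end
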